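import Summits.ValiantsHypothesis.ValiantsHypothesis.Theorems.KPlusLogSqLawTropicalBDoublingSigned

set_option linter.dupNamespace false
set_option autoImplicit false

/-! ## Route «KPlusLogSqLaw» (route-ValiantsHypothesis-KPlusLogSqLaw): SECOND LINE «doubling» on crux `TropicalB` = item stmt-ValiantsHypothesis-19771
## (crux-workfile `Cruxes/TropicalB/Lines/doubling.lean`; custody #2 conjb-2 g8, 2026-08-26; lead ruling R1545 (Q1)(ii); route text UNCHANGED rev 8 f0fe62816c62)

HONEST FRAMING.  A proof SKELETON over an OPEN conjecture of the object-search cell `pub-symmetroid`: the one `stub_*` below is `sorry` and is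
NOT claimed; nothing in this file asserts `TropicalB`, `WeakLifting`, `KPlusLogSqLaw` (B), `MatrixDescartes` (stmt-ValiantsHypothesis-18050) or
anything about VP ≠ VNP.  This is a LINE on the crux, not a re-cut of the registered birth skeleton `Lines/birth.lean` (v2, c154994ecbb5076f,
stubs `stub_tropThin` / `stub_tropFat` / `stub_tropStaticDiagonal` / `stub_tropTowerLog` stay as registered) and not a route revision.

THE LINE (one content stub; source: val-sym-trop-p2 g3, CONVEX-POSITION.md R22 + addendum, kernel files p457356/p457670 `…TropicalBDoubling`,
p457900 `…TropicalBDoublingSigned`, p457167 `…TropicalBHalves`):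

* `stub_signedDoubling` — the SIGNED BALANCED DOUBLING LAW FROM SIZE `K` ON: there is an exponent `c` such that for every `K` and every balanced
  split `m = a + e` (`K ≤ a ≤ e ≤ a + 1`) the tropical census rows (the crux's own currency `TropicalCensus.TropRootLawAt`, δ-equal to the birth
  skeleton's `TropRow`) satisfy `TropRootLawAt a K B₁ → TropRootLawAt e K B₂ → TropRootLawAt (a+e) K ((a+e)^c · (B₁ + B₂ + 2))` — doubling the
  size multiplies the alternation census by at most a polynomial in the size.  It is K-FREE in the exponent and SINGLE-SCALE.
* `TropicalB_skeleton_doubling : TropicalB` — the crux BY NAME from the stub, via the tree's kernel-checked composition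
  `Doubling.tropicalB_of_signedDoubling` (p457900; dyadic induction from slope counting at sizes `m ≤ 4K`, `C = 6(c+3) + 5`).
  `TropicalB_of_signedDoubling` records the same composition with the stub as an explicit hypothesis, concluding the UNFOLDED crux (so that the
  hypothesis-free theorem is the only declaration of this file whose conclusion head is `TropicalB` — `#h21_check_skeleton` shape, ONBOARD §0).

WHY A LINE AND NOT BOOKKEEPING (located, not claimed): every registered reduction of the crux in the tree is an EQUIVALENCE (`thinStub_iff_tropicalB`,
`fatStub_iff_tropicalB`, `tropicalB_iff_diagonal` p432162, `tropicalB_iff_staticDiagonal` p436380, `tropicalB_iff_permSteps` p441329,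
`tropicalB_iff_unsigned` p444755, `tropicalB_iff_expSqrtTower`; REGIME-COLLAPSE memo), whereas the doubling law is — as far as anyone in the cell can
prove — STRICTLY STRONGER than the crux: `TropicalB`'s budget `2^{C(K + log² m)}` is silent about jumps between consecutive sizes in the fat corner
`K ≤ a ≤ K²`, which the law forbids.  WHY EASIER (the transfer argument): (i) one scale instead of a two-parameter window; (ii) by
`Halves.halves_subadditive` (p457167: at every cut, chain length + 1 ≤ #distinct left half-terms + #distinct right half-terms, each occurring half a
dominant term of a half-size sub-design) the missing input is LOCALISED to one statement about ONE balanced cut — «the distinct half-terms of a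
sign-alternating dominant chain number at most `m^c` times the half-size alternation capacities»; (iii) the tree's unconditional instance is the
halving inequality (`tropRowD_halving`, all `C(m, m/2)` subsets as states — Hrubeš–Yehudayoff 2021 Prop. 23 shape) and the Hessenberg sector realises
`m/2 + 1` states (`…TropicalBHessenberg`).

HOW IT DIES (kill test of record, R22 addendum; honest risk stated up front): the law needs `K ≥ c + 3` before it says anything beyond counting; the
first informative pair is `(m, K) = (10, 5)` against `(5, 5)`.  RISK «counting-tight»: if the formats `(K, K)` and `(2K, K)` are both slope-counting
tight (census ≍ `C(2K−1, K)` resp. `C(3K−1, 2K)`), the ratio is `≍ (27/16)^K` and NO exponent `c` survives — the line is then DEAD while `TropicalB`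
(budget `2^{CK}` there) is untouched.  Either outcome is informative: a dead doubling line says the fat corner has exponential-in-`K` consecutive
jumps, i.e. any proof of the crux must spend its `2^{CK}` there.  A refinement that survives this particular death (law asked only for `K² ≤ a`,
base = the SQUARE TOWER `T(K², K) ≤ 2^{CK}` of trop-p5, itself below the crux by `squareTower_of_tropicalB`) is proposed in the custody memo
ROUND1f (g8), not registered here.

REGISTRATION NOTE (mechanics, for whoever registers this line): `ledger skeleton check <file> --crux stmt-ValiantsHypothesis-19771` REPLACES the
item's registered stub set by the stubs of the checked file (item payload `stubs[]` entries expire «replaced by skeleton …» / «not in skeleton …»);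
running it on THIS file alone would expire birth v2's four stubs.  Register `stub_signedDoubling` ADDITIVELY (`ledger workitem stub-add
stmt-ValiantsHypothesis-19771 --name stub_signedDoubling --signature '<the statement below>'`) or via a superset skeleton — never by a bare skeleton
check of this file.  Sorries: exactly one (`stub_signedDoubling`). -/

namespace Summit.ValiantsHypothesis.ValiantsHypothesis.Theses.KPlusLogSqLaw

open Summit.ValiantsHypothesis.ValiantsHypothesis.Theorems.LacunarySymmetroidMatrixDescartes.TropicalCensus
open Summit.ValiantsHypothesis.ValiantsHypothesis.Theorems.KPlusLogSqLaw

/-- **CONTENT stub — the SIGNED BALANCED DOUBLING LAW FROM SIZE `K` ON** (val-sym-trop-p2 g3, R22; verbatim the hypothesis of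
`Doubling.tropicalB_of_signedDoubling`, p457900): some exponent `c` works for every `K` and every balanced split `a + e`, `K ≤ a ≤ e ≤ a + 1`.
Plausibly ≥ M-sized; strictly stronger than the crux as far as the tree knows; NOT claimed.  Kill test: `(10,5)` vs `(5,5)`; risk: counting-tight
`(K,K)`/`(2K,K)` ⇒ ratio `(27/16)^K` kills every `c`. -/
theorem stub_signedDoubling :
    ∃ c : ℕ, ∀ (K a e B₁ B₂ : ℕ), K ≤ a → a ≤ e → e ≤ a + 1 → TropRootLawAt a K B₁ → TropRootLawAt e K B₂ →
      TropRootLawAt (a + e) K ((a + e) ^ c * (B₁ + B₂ + 2)) := by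
  sorry

/-- composition with the stub as an explicit hypothesis, concluding the UNFOLDED crux (head `∃`, so that `TropicalB_skeleton_doubling` is the
unique theorem of this file concluding `TropicalB` by name): the tree's `Doubling.tropicalB_of_signedDoubling` (p457900), `C = 6(c+3) + 5`. -/
theorem TropicalB_of_signedDoubling
    (h : ∃ c : ℕ, ∀ (K a e B₁ B₂ : ℕ), K ≤ a → a ≤ e → e ≤ a + 1 → TropRootLawAt a K B₁ → TropRootLawAt e K B₂ →
      TropRootLawAt (a + e) K ((a + e) ^ c * (B₁ + B₂ + 2))) :
    ∃ C : ℕ, ∀ m K : ℕ, TropRootLawAt m K (2 ^ (C * (K + Nat.log 2 m ^ 2))) := by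
  obtain ⟨c, hS⟩ := h
  exact Doubling.tropicalB_of_signedDoubling hS

/-- SKELETON THEOREM (hypothesis-free; the stub enters BY NAME): the crux `TropicalB` from `stub_signedDoubling`. -/
theorem TropicalB_skeleton_doubling : TropicalB := TropicalB_of_signedDoubling stub_signedDoubling

end Summit.ValiantsHypothesis.ValiantsHypothesis.Theses.KPlusLogSqLaw
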